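import Summits.BirchSwinnertonDyer.Rank1Residual.GaloisImage.PrimeChoiceSakamotoDeep
import Summits.BirchSwinnertonDyer.Rank1Residual.GaloisImage.PrimeChoiceSakamotoIndependent
import HarnessLib

/-!
# Sakamoto's Lemma 5.2 on the DEEP Frobenius sub-class, file 1/2: the SELECTION of `γ ∈ G_F′`
# for an independent family of cocycles plus one class (route `KimAtThreeKolyvagin`, rung W2;
# cell `bsd-addord`, seat `bsd-addord-w2-c2` gen 5)

HONEST FRAMING. TOOL theorems of group cohomology (no definition, no named fact, no `sorry`, no class
theorem, nothing booked, no mark moved; BSD is not proved by any of this). File 1 of the «missing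
lemma» of the S24-DEEP port (`GaloisImage.KolyvaginDeepSubclass`, FLAG `S24-DEEP-PORT@3`): [S24]
Lemma 5.2's group-theoretic half — the selection of `γ ∈ G_F′ = ker ρ′ ⊓ Gal(K̄/K(μ_{N′}))` with
`cᵢ(τγ), c′(τγ) ∉ (τ − 1)T̄` for cocycles `cᵢ` with `𝔽_p`-INDEPENDENT classes and one more non-zero
class — run, as the port's docstring prescribes, «with `F′ := K(μ_{N′}, T′) ⊇ F` in place of `F`,
legitimate GIVEN (H.3′)»; proofs = cell `b2b-bsdres` (team n1011, seat p15)'s pinned-class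
`PrimeChoiceSelectionIndependent.lean` with `ker ρ′ ≤ ker ρ` and the deep key lemma
`PrimeChoice.oneCocycleClass_eq_zero_of_forall_apply_mem_range_deep`.

* `exists_forall_apply_mul_notMem_range_of_restrictions_extra_deep` (dependent case, `p ≥ 3`),
* `exists_forall_apply_mul_notMem_range_of_restrictions_deep` (independent restrictions, any `p`),
* `exists_forall_apply_mul_notMem_range_of_linearIndependent_deep` (independent CLASSES plus one).
File 2 (`KimAtThreeDeepLowerS24DeepPrimeChoice`) adds Chebotarev and the `E[p]` readings.

References: R. Sakamoto, JTNB **36** (2024), Lemma 5.1, Lemma 5.2 (pp. 927–929), Lemma 6.4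
(pp. 931–932) [Sakamoto2024]; B. Mazur, K. Rubin, Mem. AMS **799** (2004), Prop. 3.6.1 (p. 31)
[MazurRubin2004].
-/

set_option autoImplicit false
-- the Theorems namespace of a single-conjunct summit repeats the summit name by design (D-0017)
set_option linter.dupNamespace false

noncomputable section

open Function
open Literature.NumberTheory.GaloisRepresentations Literature.NumberTheory.GaloisCohomology

universe u

namespace Summit.BirchSwinnertonDyer.BirchSwinnertonDyer.Theorems.KimAtThreeDeepLowerS24DeepSelection

open Summit.BirchSwinnertonDyer.Rank1Residual.GaloisImage
open Summit.BirchSwinnertonDyer.Rank1Residual.GaloisImage.PrimeChoice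

/-! ### §1 Cocycle algebra over any field: the selection on `G_F′` for an independent family -/

section Selection

variable {K : Type u} [Field K] {M : Type u} [AddCommGroup M] [TopologicalSpace M]
  [DiscreteTopology M] {ρ : DiscreteGaloisModule K M}
  {M' : Type u} [AddCommGroup M'] [TopologicalSpace M'] [DiscreteTopology M']
  {ρ' : DiscreteGaloisModule K M'}

/-- **Selection on `G_F′`, independent restrictions plus one dependent cocycle** (`p ≥ 3`; deep
class): as `PrimeChoice.exists_forall_apply_mul_notMem_range_of_restrictions_extra` with
`G_F′ = ker ρ′ ⊓ Gal(K̄/K(μ_{N′}))`, `ker ρ′ ≤ ker ρ`, and (H.3) stated for `G_F′` (for the key lemma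
`oneCocycleClass_eq_zero_of_forall_apply_mem_range_deep`, which forces `c′(τ) ≡ Σ bᵢ cᵢ(τ)`).
[cite: Sakamoto2024, Lemma 5.1 and Lemma 5.2 (pp. 927–929)] [cite: MazurRubin2004, Prop. 3.6.1 proof, p. 31] -/
theorem exists_forall_apply_mul_notMem_range_of_restrictions_extra_deep {p : ℕ} [Fact p.Prime]
    (hp : 3 ≤ p) {N' : ℕ}
    (hker : ∀ u : Field.absoluteGaloisGroup K, ρ' u = 1 → ρ u = 1)
    {τ : Field.absoluteGaloisGroup K} (e : cokerSubOne ρ τ ≃+ ZMod p)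
    (hirr : ∀ A : AddSubgroup M,
      (∀ (s : Field.absoluteGaloisGroup K), ∀ m ∈ A, ρ s m ∈ A) → A = ⊥ ∨ A = ⊤)
    (hH3 : ∀ f : contOneCocycles ρ.toTopRep,
      (∀ u : Field.absoluteGaloisGroup K, ρ' u = 1 → u ∈ rootsOfUnityFixer K N' → f.1 u = 0) →
        oneCocycleClass ρ.toTopRep f = 0)
    {ι : Type*} [Fintype ι] [DecidableEq ι] (c : ι → contOneCocycles ρ.toTopRep)
    (hres : ∀ a : ι → ZMod p,
      (∀ g : Field.absoluteGaloisGroup K, ρ' g = 1 → g ∈ rootsOfUnityFixer K N' →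
        ∑ i, a i * e (QuotientAddGroup.mk ((c i).1 g)) = 0) → a = 0)
    (c' : contOneCocycles ρ.toTopRep) {b : ι → ZMod p} (hb : b ≠ 0)
    (hdep : ∀ g : Field.absoluteGaloisGroup K, ρ' g = 1 → g ∈ rootsOfUnityFixer K N' →
      (e (QuotientAddGroup.mk (c'.1 g)) : ZMod p) = ∑ i, b i * e (QuotientAddGroup.mk ((c i).1 g))) :
    ∃ γ : Field.absoluteGaloisGroup K, ρ' γ = 1 ∧ γ ∈ rootsOfUnityFixer K N' ∧
      (∀ i, (c i).1 (τ * γ) ∉ ((ρ τ).toAddMonoidHom - AddMonoidHom.id M).range) ∧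
      c'.1 (τ * γ) ∉ ((ρ τ).toAddMonoidHom - AddMonoidHom.id M).range := by
  classical
  -- the group `G_F′ = ker ρ′ ⊓ Gal(K̄/K(μ_{N′}))` as a subgroup
  set GF : Subgroup (Field.absoluteGaloisGroup K) := ρ'.ker ⊓ rootsOfUnityFixer K N' with hGF_def
  have hmemGF : ∀ g : Field.absoluteGaloisGroup K, g ∈ GF ↔ ρ' g = 1 ∧ g ∈ rootsOfUnityFixer K N' :=
    fun g => by rw [hGF_def, Subgroup.mem_inf, ContinuousRep.mem_ker]; exact Iff.rfl
  set R : AddSubgroup M := ((ρ τ).toAddMonoidHom - AddMonoidHom.id M).range with hR_def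
  -- `π = e ∘ (mod (τ − 1)T̄) : T̄ → 𝔽_p`
  let π : M →+ ZMod p := e.toAddMonoidHom.comp (QuotientAddGroup.mk' R)
  have hπ : ∀ m, π m = e (QuotientAddGroup.mk m) := fun m => rfl
  have hπ0 : ∀ m, π m = 0 ↔ m ∈ R := fun m => by
    rw [hπ, e.map_eq_zero_iff, QuotientAddGroup.eq_zero_iff]
  -- the data of the covering lemma
  let E : ι → (↥GF → ZMod p) := fun i g => π ((c i).1 g)
  let F : (ι → ZMod p) →ₗ[ZMod p] (↥GF → ZMod p) := Fintype.linearCombination (ZMod p) E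
  have hFapply : ∀ a (g : GF), F a g = ∑ i, a i * π ((c i).1 g) := fun a g => by
    change (Fintype.linearCombination (ZMod p) E a) g = _
    rw [Fintype.linearCombination_apply, Finset.sum_apply]
    simp only [Pi.smul_apply, smul_eq_mul, E]
  have hFsingle : ∀ i (g : GF), F (Pi.single i 1) g = π ((c i).1 g) := fun i g => by
    change (Fintype.linearCombination (ZMod p) E (Pi.single i 1)) g = _
    rw [Fintype.linearCombination_apply_single, one_smul]
  have hFmul : ∀ a (g h : GF), F a (g * h) = F a g + F a h := by
    intro a g h
    rw [hFapply, hFapply, hFapply, ← Finset.sum_add_distrib]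
    refine Finset.sum_congr rfl fun i _ => ?_
    rw [Subgroup.coe_mul, apply_mul_of_apply_eq_one (c i) (hker _ ((hmemGF g).mp g.2).1), map_add,
      mul_add]
  have hkerF : ∀ a, F a = 0 → a = 0 := fun a ha =>
    hres a fun g hg hgμ => by
      have h := congrFun ha ⟨g, (hmemGF g).mpr ⟨hg, hgμ⟩⟩
      rw [hFapply] at h
      exact h
  -- the value of `c′` at `τ` is forced: `c′(τ) ≡ Σ bᵢ cᵢ(τ)` (deep key lemma applied to `c′ − Σ b̃ᵢ cᵢ`)
  haveI : NeZero p := ⟨(Fact.out : p.Prime).ne_zero⟩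
  have hcomb : ∀ (a : ι → ZMod p) (g : Field.absoluteGaloisGroup K),
      π ((∑ i, (a i).val • c i : contOneCocycles ρ.toTopRep).1 g) = ∑ i, a i * π ((c i).1 g) :=
    fun a g => map_sum_val_nsmul_apply π c a g
  have hτval : π (c'.1 τ) = ∑ i, b i * π ((c i).1 τ) := by
    set ψ : contOneCocycles ρ.toTopRep := c' - ∑ i, (b i).val • c i with hψ_def
    have hψapply : ∀ g, ψ.1 g = c'.1 g - (∑ i, (b i).val • c i : contOneCocycles ρ.toTopRep).1 g :=
      fun g => rfl
    have hψ : oneCocycleClass ρ.toTopRep ψ = 0 := by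
      refine oneCocycleClass_eq_zero_of_forall_apply_mem_range_deep hker e hirr hH3 ψ fun g hg hgμ => ?_
      rw [← hπ0, hψapply, map_sub, hcomb, hπ, hdep g hg hgμ]
      exact sub_self _
    obtain ⟨v, hv⟩ := (oneCocycleClass_eq_zero_iff _ ψ).mp hψ
    have hτR : ψ.1 τ ∈ R := by rw [hv τ]; exact ⟨v, rfl⟩
    rw [← hπ0, hψapply, map_sub, hcomb, sub_eq_zero] at hτR
    exact hτR
  -- covering lemma, dependent case
  obtain ⟨g, hg, hg'⟩ := exists_forall_apply_add_ne_zero_and_sum_of_ker_eq_bot hp F hFmul hkerF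
    (fun i => π ((c i).1 τ)) hb (π (c'.1 τ))
  refine ⟨g, ((hmemGF g).mp g.2).1, ((hmemGF g).mp g.2).2, fun i hi => ?_, fun h' => ?_⟩
  · apply hg i
    rw [hFsingle, add_comm, hπ, hπ, ← map_add, ← mk_apply_mul_eq τ _ (c i), ← hπ, hπ0]
    exact hi
  · apply hg'
    have h1 : ∑ i, b i * F (Pi.single i 1) g = π (c'.1 g) := by
      simp only [hFsingle, hπ]
      exact (hdep g ((hmemGF g).mp g.2).1 ((hmemGF g).mp g.2).2).symm
    rw [h1, add_comm, hπ, hπ, ← map_add, ← mk_apply_mul_eq τ _ c', ← hπ, hπ0]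
    exact h'

/-- **Selection on `G_F′`, independent restrictions** (any `p`; no (H.1)/(H.3) needed; deep class):
as `PrimeChoice.exists_forall_apply_mul_notMem_range_of_restrictions` with
`G_F′ = ker ρ′ ⊓ Gal(K̄/K(μ_{N′}))`, `ker ρ′ ≤ ker ρ`. [cite: Sakamoto2024, Lemma 5.1 (pp. 927–928)] -/
theorem exists_forall_apply_mul_notMem_range_of_restrictions_deep {p : ℕ} [Fact p.Prime] {N' : ℕ}
    (hker : ∀ u : Field.absoluteGaloisGroup K, ρ' u = 1 → ρ u = 1)
    {τ : Field.absoluteGaloisGroup K} (e : cokerSubOne ρ τ ≃+ ZMod p)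
    {ι : Type*} [Fintype ι] [DecidableEq ι] (c : ι → contOneCocycles ρ.toTopRep)
    (hres : ∀ a : ι → ZMod p,
      (∀ g : Field.absoluteGaloisGroup K, ρ' g = 1 → g ∈ rootsOfUnityFixer K N' →
        ∑ i, a i * e (QuotientAddGroup.mk ((c i).1 g)) = 0) → a = 0) :
    ∃ γ : Field.absoluteGaloisGroup K, ρ' γ = 1 ∧ γ ∈ rootsOfUnityFixer K N' ∧
      ∀ i, (c i).1 (τ * γ) ∉ ((ρ τ).toAddMonoidHom - AddMonoidHom.id M).range := by
  classical
  set GF : Subgroup (Field.absoluteGaloisGroup K) := ρ'.ker ⊓ rootsOfUnityFixer K N' with hGF_def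
  have hmemGF : ∀ g : Field.absoluteGaloisGroup K, g ∈ GF ↔ ρ' g = 1 ∧ g ∈ rootsOfUnityFixer K N' :=
    fun g => by rw [hGF_def, Subgroup.mem_inf, ContinuousRep.mem_ker]; exact Iff.rfl
  set R : AddSubgroup M := ((ρ τ).toAddMonoidHom - AddMonoidHom.id M).range with hR_def
  let π : M →+ ZMod p := e.toAddMonoidHom.comp (QuotientAddGroup.mk' R)
  have hπ : ∀ m, π m = e (QuotientAddGroup.mk m) := fun m => rfl
  have hπ0 : ∀ m, π m = 0 ↔ m ∈ R := fun m => by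
    rw [hπ, e.map_eq_zero_iff, QuotientAddGroup.eq_zero_iff]
  let E : ι → (↥GF → ZMod p) := fun i g => π ((c i).1 g)
  let F : (ι → ZMod p) →ₗ[ZMod p] (↥GF → ZMod p) := Fintype.linearCombination (ZMod p) E
  have hFapply : ∀ a (g : GF), F a g = ∑ i, a i * π ((c i).1 g) := fun a g => by
    change (Fintype.linearCombination (ZMod p) E a) g = _
    rw [Fintype.linearCombination_apply, Finset.sum_apply]
    simp only [Pi.smul_apply, smul_eq_mul, E]
  have hFsingle : ∀ i (g : GF), F (Pi.single i 1) g = π ((c i).1 g) := fun i g => by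
    change (Fintype.linearCombination (ZMod p) E (Pi.single i 1)) g = _
    rw [Fintype.linearCombination_apply_single, one_smul]
  have hFmul : ∀ a (g h : GF), F a (g * h) = F a g + F a h := by
    intro a g h
    rw [hFapply, hFapply, hFapply, ← Finset.sum_add_distrib]
    refine Finset.sum_congr rfl fun i _ => ?_
    rw [Subgroup.coe_mul, apply_mul_of_apply_eq_one (c i) (hker _ ((hmemGF g).mp g.2).1), map_add,
      mul_add]
  have hkerF : ∀ a, F a = 0 → a = 0 := fun a ha =>
    hres a fun g hg hgμ => by
      have h := congrFun ha ⟨g, (hmemGF g).mpr ⟨hg, hgμ⟩⟩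
      rw [hFapply] at h
      exact h
  obtain ⟨g, hg⟩ := exists_forall_apply_add_ne_zero_of_ker_eq_bot F hFmul hkerF
    fun i => π ((c i).1 τ)
  refine ⟨g, ((hmemGF g).mp g.2).1, ((hmemGF g).mp g.2).2, fun i hi => ?_⟩
  apply hg i
  rw [hFsingle, add_comm, hπ, hπ, ← map_add, ← mk_apply_mul_eq τ _ (c i), ← hπ, hπ0]
  exact hi

/-- **THE SELECTION on `G_F′` for an independent family plus one class** ([S24] Lemma 5.2's
group-theoretic half in the form Lemma 6.4 uses; `p ≥ 3`; deep class): classes `[cᵢ]`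
`𝔽_p`-linearly independent in `H¹(K, T̄)`, `[c′] ≠ 0`, (H.1), (H.3) on
`G_F′ = ker ρ′ ⊓ Gal(K̄/K(μ_{N′}))` (`ker ρ′ ≤ ker ρ`), `T̄/(τ − 1)T̄ ≃ ℤ/p` ⟹ `∃ γ ∈ G_F′` with every
`cᵢ(τγ) ∉ (τ − 1)T̄` and `c′(τγ) ∉ (τ − 1)T̄`. Proof = n1011's pinned
`exists_forall_apply_mul_notMem_range_of_linearIndependent` with the deep key lemma.
[cite: Sakamoto2024, Lemma 5.2 (p. 928) and Lemma 6.4 (pp. 931–932)] [cite: MazurRubin2004, Prop. 3.6.1 proof, p. 31] -/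
theorem exists_forall_apply_mul_notMem_range_of_linearIndependent_deep {p : ℕ} [Fact p.Prime]
    (hp : 3 ≤ p) {N' : ℕ}
    (hker : ∀ u : Field.absoluteGaloisGroup K, ρ' u = 1 → ρ u = 1)
    {τ : Field.absoluteGaloisGroup K} (e : cokerSubOne ρ τ ≃+ ZMod p)
    (hirr : ∀ A : AddSubgroup M,
      (∀ (s : Field.absoluteGaloisGroup K), ∀ m ∈ A, ρ s m ∈ A) → A = ⊥ ∨ A = ⊤)
    (hH3 : ∀ f : contOneCocycles ρ.toTopRep,
      (∀ u : Field.absoluteGaloisGroup K, ρ' u = 1 → u ∈ rootsOfUnityFixer K N' → f.1 u = 0) →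
        oneCocycleClass ρ.toTopRep f = 0)
    {ι : Type*} [Fintype ι] [DecidableEq ι] (c : ι → contOneCocycles ρ.toTopRep)
    (hind : ∀ a : ι → ZMod p,
      (∑ i, (a i).val • oneCocycleClass ρ.toTopRep (c i)) = 0 → a = 0)
    (c' : contOneCocycles ρ.toTopRep) (hc' : oneCocycleClass ρ.toTopRep c' ≠ 0) :
    ∃ γ : Field.absoluteGaloisGroup K, ρ' γ = 1 ∧ γ ∈ rootsOfUnityFixer K N' ∧
      (∀ i, (c i).1 (τ * γ) ∉ ((ρ τ).toAddMonoidHom - AddMonoidHom.id M).range) ∧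
      c'.1 (τ * γ) ∉ ((ρ τ).toAddMonoidHom - AddMonoidHom.id M).range := by
  classical
  set R : AddSubgroup M := ((ρ τ).toAddMonoidHom - AddMonoidHom.id M).range with hR_def
  let π : M →+ ZMod p := e.toAddMonoidHom.comp (QuotientAddGroup.mk' R)
  have hπ : ∀ m, π m = e (QuotientAddGroup.mk m) := fun m => rfl
  have hπ0 : ∀ m, π m = 0 ↔ m ∈ R := fun m => by
    rw [hπ, e.map_eq_zero_iff, QuotientAddGroup.eq_zero_iff]
  haveI : NeZero p := ⟨(Fact.out : p.Prime).ne_zero⟩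
  -- independence of CLASSES ⟹ independence of the restrictions to `G_F′` modulo `(τ − 1)T̄`
  have hres : ∀ a : ι → ZMod p,
      (∀ g : Field.absoluteGaloisGroup K, ρ' g = 1 → g ∈ rootsOfUnityFixer K N' →
        ∑ i, a i * e (QuotientAddGroup.mk ((c i).1 g)) = 0) → a = 0 := by
    intro a ha
    refine hind a ?_
    rw [← oneCocycleClass_sum_nsmul c fun i => (a i).val]
    refine oneCocycleClass_eq_zero_of_forall_apply_mem_range_deep hker e hirr hH3 _ fun g hg hgμ => ?_
    rw [← hπ0, map_sum_val_nsmul_apply π c a g]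
    exact ha g hg hgμ
  by_cases hD : ∃ b : ι → ZMod p, ∀ g : Field.absoluteGaloisGroup K, ρ' g = 1 →
      g ∈ rootsOfUnityFixer K N' →
        (e (QuotientAddGroup.mk (c'.1 g)) : ZMod p) = ∑ i, b i * e (QuotientAddGroup.mk ((c i).1 g))
  · -- dependent case: `c̄′ = Σ bᵢ c̄ᵢ` on `G_F′`, with `b ≠ 0` since `[c′] ≠ 0`
    obtain ⟨b, hb⟩ := hD
    have hb0 : b ≠ 0 := by
      rintro rfl
      refine hc' (oneCocycleClass_eq_zero_of_forall_apply_mem_range_deep hker e hirr hH3 c'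
        fun g hg hgμ => ?_)
      rw [← hπ0, hπ, hb g hg hgμ]
      simp only [Pi.zero_apply, zero_mul, Finset.sum_const_zero]
    exact exists_forall_apply_mul_notMem_range_of_restrictions_extra_deep hp hker e hirr hH3 c hres c'
      hb0 hb
  · -- independent case: the family on `Option ι` (`none ↦ c′`) has independent restrictions
    push Not at hD
    let d : Option ι → contOneCocycles ρ.toTopRep := fun o => o.elim c' c
    have hres' : ∀ a : Option ι → ZMod p,
        (∀ g : Field.absoluteGaloisGroup K, ρ' g = 1 → g ∈ rootsOfUnityFixer K N' →
          ∑ o, a o * e (QuotientAddGroup.mk ((d o).1 g)) = 0) → a = 0 := by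
      intro a ha
      have hsplit : ∀ g : Field.absoluteGaloisGroup K,
          ∑ o, a o * e (QuotientAddGroup.mk ((d o).1 g)) =
            a none * e (QuotientAddGroup.mk (c'.1 g)) +
              ∑ i, a (some i) * e (QuotientAddGroup.mk ((c i).1 g)) := fun g => by
        rw [Fintype.sum_option]
        rfl
      -- the coefficient of `c′` vanishes, else `c̄′` is a combination of the `c̄ᵢ`
      have hnone : a none = 0 := by
        by_contra hne
        obtain ⟨g, hg, hgμ, hneq⟩ := hD (fun i => -(a none)⁻¹ * a (some i))
        apply hneq
        have h := ha g hg hgμ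
        rw [hsplit] at h
        have h' : e (QuotientAddGroup.mk (c'.1 g)) =
            -(a none)⁻¹ * ∑ i, a (some i) * e (QuotientAddGroup.mk ((c i).1 g)) := by
          have := congrArg (fun x => (a none)⁻¹ * x) h
          simp only [mul_add, ← mul_assoc, inv_mul_cancel₀ hne, one_mul, mul_zero] at this
          linear_combination this
        rw [h', Finset.mul_sum]
        exact Finset.sum_congr rfl fun i _ => by ring
      have hsome : (fun i => a (some i)) = 0 := by
        refine hres _ fun g hg hgμ => ?_
        have h := ha g hg hgμ
        rw [hsplit, hnone, zero_mul, zero_add] at h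
        exact h
      funext o
      cases o with
      | none => exact hnone
      | some i => exact congrFun hsome i
    obtain ⟨γ, hγρ, hγμ, hγ⟩ :=
      exists_forall_apply_mul_notMem_range_of_restrictions_deep (N' := N') hker e d hres'
    exact ⟨γ, hγρ, hγμ, fun i => hγ (some i), hγ none⟩

end Selection

end Summit.BirchSwinnertonDyer.BirchSwinnertonDyer.Theorems.KimAtThreeDeepLowerS24DeepSelection

end
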